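import Literature.Computability.AlgebraicComplexity.Yab15BRankGrowth
import Literature.Computability.AlgebraicComplexity.Yab15BRankMainTheorem
import HarnessLib

/-!
# Yabe 2015, Corollary 1.6 — proof of the named fact `yabe2015_cor_1_6`

Topic `Literature/Computability/AlgebraicComplexity`; cell val-lit (D-0074), DAG.tsv row Yabe2015-A.
A. Yabe, *Bi-polynomial rank and determinantal complexity*, arXiv:1504.00151 [Yabe2015], Corollary 1.6
(p0003): a growth `brank(perm_{d,X_d}^{(2k)}) = Ω(d^{2k})` of the bi-polynomial rank of the degree-`2k`
part of the permanent at zeros `X_d` forces `dc(perm_d) = Ω(d^{2k})` — as typed,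
`Literature.Computability.AlgebraicComplexity.yabe2015_cor_1_6` (`Yab15BRank.lean`). The corollary is
Theorem 1.5 plus bookkeeping; the bookkeeping is the tree's `yabe2015_cor_1_6_of_thm_1_5`
(`Yab15BRankGrowth.lean`, val-lit p8) and Theorem 1.5 is now the tree's `yabe2015_thm_1_5_holds`
(`Yab15BRankMainTheorem.lean`, val-lit p7), so the named fact is discharged by one application. This
file exists only to join the two (neither imports the other); the `Summits/`-side copy at universe `0`
is `yabe2015_cor_1_6_holds'` (`LMRWhatWouldSufficeYabe.lean`, lead-lmr LWS4). Honest framing: a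
conditional template (its hypothesis, superquadratic b-rank growth at zeros of the permanent, is
open); nothing here bears on VP versus VNP.

## References

* [Yabe2015] A. Yabe, *Bi-polynomial rank and determinantal complexity*, arXiv:1504.00151 (2015),
  Thm. 1.5, Cor. 1.6 (p0003).
-/

namespace Literature.Computability.AlgebraicComplexity

universe u

/-- **Yabe 2015, Cor. 1.6 — PROVED** (discharges the named fact `yabe2015_cor_1_6`): Theorem 1.5
(`yabe2015_thm_1_5_holds`) fed to the bookkeeping bridge `yabe2015_cor_1_6_of_thm_1_5`.
[cite: Yabe2015, Corollary 1.6] -/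
theorem yabe2015_cor_1_6_holds : yabe2015_cor_1_6.{u} :=
  yabe2015_cor_1_6_of_thm_1_5 yabe2015_thm_1_5_holds

end Literature.Computability.AlgebraicComplexity
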